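import Literature.Probability.LatticeModels.PlaneRotatorStiffnessLiminf
import Literature.Probability.LatticeModels.LayeredPlaneRotatorSusceptibility
import Literature.Probability.LatticeModels.PlaneRotatorPowerLawLowerBound
import Literature.Probability.LatticeModels.LayeredPlaneRotatorStarRegion
import Literature.Probability.LatticeModels.AnisotropicPlaneRotatorLROInfrared
import Literature.Probability.LatticeModels.AnisotropicInfraredConstantBound
import Literature.Probability.LatticeModels.AnisotropicInfraredConstantLog
import Literature.Probability.LatticeModels.KLSConstantHalf
import Literature.Probability.LatticeModels.LatticeGreenThreeCertificate
import Mathlib.Topology.Order.OrderClosed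
import HarnessLib

/-!
# The transition couplings of the plane-rotator comparison model as typed objects:
# `K_χ(ν)`, `K_Υ` and the layered `K_χ^{3D}(Δ)`, with `K_χ(2) ≤ K_Υ`, `2β_c(d) ≤ K_χ(d)`,
# `K_χ^{3D}(Δ) ≤ K_χ(2)` and `K_χ^{3D}(Δ) → K_χ(2)` as `Δ → 0⁺`

Topic `Literature/Probability/LatticeModels`. The cell's classical comparison model (nearest-neighbour plane rotator
on `ℤ^ν` at reduced coupling `K = βJ = J/T`, free boundary conditions; layered version on `ℤ³` with in-plane `K∥ = K`
and inter-layer `K⊥ = Δ·K`) has, in the tree, an infinite-volume two-point function `G_K` (`PlaneRotator.infTwoPoint`,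
B. Simon, Comm. Math. Phys. **77** (1980) 111, Thm 1.3), its layered twin `G^{3D}` (`PlaneRotator.infTwoPointLayered`)
and the infinite-volume stiffness `Υ_∞(K) = liminf_L βΥ_L(K)` (`torusXYStiffnessLiminf`, M. E. Fisher, M. N. Barber,
D. Jasnow, Phys. Rev. A **8** (1973) 1111, §II). The cell's words «`T_Υ ≤ T_χ`», «`T_χ^{3D}(J∥, J⊥) ≥ T_χ^{2D}(J∥)`»,
«`T_χ^{3D} → T_χ^{2D}` as `J⊥ → 0`» were so far `∀∃` statements about windows. This file gives them literal
referents — three **transition couplings**, extended-nonnegative-real valued so that «no transition» is the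
honest value `∞` and no junk value occurs:

* `susceptibilityCriticalCoupling ν = K_χ(ν) := sup {K ≥ 0 : ∑_x G_K(0,x) < ∞}` — by Griffiths–Ginibre
  monotonicity in the coupling (tree `summable_infTwoPoint_of_le`, J. Ginibre, Comm. Math. Phys. **16** (1970) 310)
  this is a **sharp threshold**: `χ(K) < ∞` for `0 ≤ K < K_χ` and `χ(K) = ∞` for `K > K_χ`
  (`summable_infTwoPoint_of_ofReal_lt`, `not_summable_infTwoPoint_of_lt_ofReal`); `2β_c(d) ≤ K_χ(d)` in every
  `d ≥ 2` (Aizenman–Simon, Phys. Lett. A **76** (1980) 281, eq. (2), tree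
  `exists_nnBoxShellSum_lt_one_of_lt_two_mul_criticalBeta` + Simon's lattice sum in every dimension), so
  `log(1+√2) ≤ K_χ(2)`; under Fröhlich–Spencer's Theorem C (the tree's named fact `FrohlichSpencerPowerLawLowerBound`,
  hypothesis) `K_χ(2) ≤ K₁ < ∞` — the transition EXISTS; `K_χ(ν) = ∞ ↔ χ(K) < ∞` for every `K ≥ 0`.
* `stiffnessCriticalCoupling = K_Υ := inf {K ≥ 0 : Υ_∞(K) > 0}` — `Υ_∞ = 0` below it by definition, and
  **`K_χ(2) ≤ K_Υ`** (`Υ_∞(K) > 0 ⇒ χ(K) = ∞`, tree `not_summable_infTwoPoint_of_torusXYStiffnessLiminf_pos`,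
  Simon–Lieb): the cell's «`T_Υ ≤ T_χ ≤ J/(2β_c(2)) ≤ 1.1346·J`» as inequalities between elements of `[0, ∞]`;
  `K_Υ = ∞ ↔ Υ_∞ ≡ 0` on `K ≥ 0` (nothing in the tree excludes it: `Υ_∞ > 0` is Fröhlich–Spencer-level and is claimed
  nowhere); a stiffness profile positive on `(0, T_c)` has `K_Υ ≤ J/T_c` (`T_c ≤ T_Υ := J/K_Υ`).
* `layeredSusceptibilityCriticalCoupling Δ = K_χ^{3D}(Δ) := sup {K ≥ 0 : ∑_z G^{3D}_{(K, ΔK)}(0,z) < ∞}` for the stack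
  with anisotropy `Δ = J⊥/J∥ ≥ 0` — sharp threshold in `K` likewise; **`K_χ^{3D}(Δ) ≤ K_χ(2)`** for every `Δ ≥ 0`
  (a layer sits below the stack, tree `summable_layer_of_summable_layered`), **antitone in `Δ`**, `K_χ^{3D}(0) = K_χ(2)`,
  and **`K_χ^{3D}(Δ) → K_χ(2)` as `Δ → 0⁺`** (tree `summable_layered_of_summable_layer`: the single layer's
  finite-susceptibility phase survives weak interlayer coupling) — Liu–Stanley's `T_c(ε) → T_c^{2D}`
  (Phys. Rev. Lett. **29** (1972) 927; Phys. Rev. B **8** (1973) 2279) for the susceptibility transition of the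
  classical layered XY model, as a limit of numbers; the isotropic endpoint `K_χ^{3D}(1) = K_χ(3) ≥ 2β_c(3)`;
  Lieb's star region (tree `summable_layered_of_amos_star_lt_one`, E. H. Lieb, Comm. Math. Phys. **77** (1980) 127,
  Thm 4) as an explicit floor under `K_χ^{3D}(Δ)`.
* **Ceilings from the infrared bound** (J. Fröhlich, R. Israel, E. H. Lieb, B. Simon, Comm. Math. Phys. **62** (1978) 1,
  Thm 4.7; T. Kennedy, E. H. Lieb, B. S. Shastry, J. Stat. Phys. **53** (1988) 1019, eq. (7); tree
  `layered_longRangeOrder_infraredBound` + `not_summable_layered_of_plateau_ge`): **`K_χ^{3D}(Δ) ≤ C(Δ)`** for every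
  `0 < Δ ≤ 1` (`C` = `AnisotropicRotator.klsConstant`), `≤ 1 + ln(1/Δ)/(2π)` in closed form, with the tree's kernel
  decimals `K_χ^{3D}(Δ) ≤ 0.627` for `Δ ≥ ½` (`klsConstant_half_le`) and `1/3 ≤ K_χ(3) ≤ R(3) ≤ 0.5094` (Watson's
  constant, `latticeGreen_three_zero_mem_Icc`): the stack's susceptibility transition coupling is BRACKETED between two
  kernel quantities at every anisotropy, `K_⋆(Δ) ≤ K_χ^{3D}(Δ) ≤ min (K_χ(2), C(Δ))`.

In temperature units (`T = J/K`, `J = J∥`): `T_χ^{3D}(J∥, ΔJ∥) = J∥/K_χ^{3D}(Δ) ≥ T_χ^{2D}(J∥) = J∥/K_χ(2) ≥ T_Υ^{2D}(J∥)`,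
`T_χ^{2D}(J) ≤ J/(2β_c(2)) ≤ J/log(1+√2)`, `T_χ^{3D}(J∥, ΔJ∥) ↓ T_χ^{2D}(J∥)` as `Δ → 0⁺`,
`T_χ^{3D}(J∥, ΔJ∥) ≥ J∥/C(Δ)` (`≥ 1.59·J∥` for `Δ ≥ ½`; `1.963·J ≤ T_χ^{XY}(ℤ³) ≤ 3·J`).

Cell `pub/hubbard-tc` (MO-S3; G2 2D→3D ordering lemma in susceptibility currency, K2 register typing), classical
comparison model only, number-neutral. WHAT THIS IS NOT: no value of `K_χ` or `K_Υ` beyond the displayed bounds; not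
`Υ_∞ > 0` anywhere, not `K_χ = K_Υ` (Kosterlitz–Thouless), not a statement about the Hubbard model or any material.
-/

noncomputable section

open MeasureTheory Finset Filter Topology
open scoped BigOperators ENNReal

namespace Literature.Probability.LatticeModels

namespace PlaneRotator

open Literature.Barriers.CriticalPhenomena Literature.Barriers.CriticalPhenomena.LongRangeIsing

variable [MeasurableSpace Circle] [BorelSpace Circle]

/-! ## §1 Finite susceptibility throughout Aizenman–Simon's window, in every dimension -/

section EveryDimension

variable {ν : ℕ}

/-- **The susceptibility of the plane rotator on `ℤ^d` is finite throughout Aizenman–Simon's window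
`0 ≤ K < 2β_c(d)`** (`d ≥ 2`; `β_c(d)` the Ising critical point): a terminating box exists there
(`exists_nnBoxShellSum_lt_one_of_lt_two_mul_criticalBeta`, on the proved sharpness of the Ising transition), and a
terminating cube certifies a finite susceptibility in every dimension (tree `summable_infTwoPoint_of_cube_lt_one`:
Lieb's box bound in infinite volume summed with Simon's lattice sum). [cite: AizenmanSimon1980RotorIsing, eqs. (1)–(2); Simon1980CMP, Thm 1.3; Lieb1980, p. 128 (boxes)] -/
theorem summable_infTwoPoint_of_lt_two_mul_criticalBeta {d : ℕ} (hd : 2 ≤ d) {K : ℝ} (hK0 : 0 ≤ K)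
    (hK : K < 2 * criticalBeta d) : Summable fun x : Site d => infTwoPoint K d 0 x := by
  obtain ⟨R, hR, hS⟩ := exists_nnBoxShellSum_lt_one_of_lt_two_mul_criticalBeta (d := d) hd hK0 hK
  exact summable_infTwoPoint_of_cube_lt_one hK0 hR hS

end EveryDimension

/-! ## §2 The susceptibility transition coupling `K_χ(ν)` -/

section Susceptibility

variable {ν : ℕ}

/-- **The susceptibility transition coupling of the plane rotator on `ℤ^ν`**,
`K_χ(ν) := sup {K ≥ 0 : χ(K) = ∑_x G_K(0, x) < ∞} ∈ [0, ∞]` (the supremum of the high-temperature phase on the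
reduced-coupling axis `K = βJ`; `∞` if the susceptibility is finite at every coupling). In temperature units the
susceptibility transition temperature is `T_χ(J) = J/K_χ`. (Simon: `χ < ∞` is the phase of exponential clustering,
Thm 1.3; Fröhlich–Spencer: it ends at finite `K` in `ν = 2`.) [cite: Simon1980CMP, Thm 1.3 (the phase Σ⟨s₀s_x⟩ < ∞); FrohlichSpencerKT1981, §1.4 Theorem C (p. 534)] -/
def susceptibilityCriticalCoupling (ν : ℕ) : ℝ≥0∞ :=
  ⨆ (K : ℝ) (_ : 0 ≤ K ∧ Summable fun x : Site ν => infTwoPoint K ν 0 x), ENNReal.ofReal K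

/-- Every coupling with finite susceptibility lies below `K_χ`: `0 ≤ K`, `χ(K) < ∞ ⇒ K ≤ K_χ(ν)`.
[cite: Simon1980CMP, Thm 1.3] -/
theorem ofReal_le_susceptibilityCriticalCoupling {K : ℝ} (hK : 0 ≤ K)
    (hG : Summable fun x : Site ν => infTwoPoint K ν 0 x) :
    ENNReal.ofReal K ≤ susceptibilityCriticalCoupling ν :=
  le_iSup_of_le (f := fun K : ℝ => ⨆ (_ : 0 ≤ K ∧ Summable fun x : Site ν => infTwoPoint K ν 0 x),
    ENNReal.ofReal K) K (le_iSup (fun _ : 0 ≤ K ∧ Summable fun x : Site ν => infTwoPoint K ν 0 x =>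
      ENNReal.ofReal K) ⟨hK, hG⟩)

/-- **Below `K_χ` the susceptibility is finite** (sharpness, lower side): `0 ≤ K`, `K < K_χ(ν) ⇒ χ(K) < ∞` — there is
a larger coupling with finite susceptibility, and the finite-susceptibility phase is a down-set in `K`
(Griffiths–Ginibre, `summable_infTwoPoint_of_le`). [cite: Ginibre1970, Prop. 3 with Example 4 (plane rotators); Simon1980CMP, Thm 1.3] -/
theorem summable_infTwoPoint_of_ofReal_lt {K : ℝ} (hK : 0 ≤ K)
    (h : ENNReal.ofReal K < susceptibilityCriticalCoupling ν) :
    Summable fun x : Site ν => infTwoPoint K ν 0 x := by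
  unfold susceptibilityCriticalCoupling at h
  obtain ⟨K', hK'⟩ := lt_iSup_iff.1 h
  obtain ⟨⟨hK'0, hG'⟩, hlt⟩ := lt_iSup_iff.1 hK'
  have hKK' : K < K' := (ENNReal.ofReal_lt_ofReal_iff_of_nonneg hK).1 hlt
  exact summable_infTwoPoint_of_le hK hKK'.le hG'

/-- **Above `K_χ` the susceptibility is infinite** (sharpness, upper side): `K_χ(ν) < K ⇒ χ(K) = ∞`.
[cite: Ginibre1970, Prop. 3 with Example 4 (plane rotators); Simon1980CMP, Thm 1.3] -/
theorem not_summable_infTwoPoint_of_lt_ofReal {K : ℝ} (h : susceptibilityCriticalCoupling ν < ENNReal.ofReal K) :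
    ¬ Summable fun x : Site ν => infTwoPoint K ν 0 x := by
  intro hG
  by_cases hK : 0 ≤ K
  · exact absurd h (not_lt.2 (ofReal_le_susceptibilityCriticalCoupling hK hG))
  · rw [ENNReal.ofReal_of_nonpos (le_of_not_ge hK)] at h
    exact absurd h (not_lt.2 zero_le)

/-- A coupling with infinite susceptibility lies above `K_χ`: `0 ≤ K`, `χ(K) = ∞ ⇒ K_χ(ν) ≤ K` (every coupling of
the high-temperature phase is `< K`, by monotonicity). [cite: Ginibre1970, Prop. 3 with Example 4 (plane rotators); Simon1980CMP, Thm 1.3] -/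
theorem susceptibilityCriticalCoupling_le_ofReal_of_not_summable {K : ℝ} (hK : 0 ≤ K)
    (h : ¬ Summable fun x : Site ν => infTwoPoint K ν 0 x) :
    susceptibilityCriticalCoupling ν ≤ ENNReal.ofReal K := by
  refine iSup₂_le fun K' hK' => ENNReal.ofReal_le_ofReal ?_
  by_contra hlt
  exact h (summable_infTwoPoint_of_le hK (le_of_not_ge hlt) hK'.2)

/-- A whole interval of finite susceptibility bounds `K_χ` from below: if `χ(K) < ∞` for every `0 ≤ K < c` then
`c ≤ K_χ(ν)`. [cite: Simon1980CMP, Thm 1.3] -/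
theorem ofReal_le_susceptibilityCriticalCoupling_of_forall_lt {c : ℝ}
    (h : ∀ K : ℝ, 0 ≤ K → K < c → Summable fun x : Site ν => infTwoPoint K ν 0 x) :
    ENNReal.ofReal c ≤ susceptibilityCriticalCoupling ν := by
  refine le_of_forall_lt fun a ha => ?_
  have ha_top : a ≠ ⊤ := ne_top_of_lt ha
  have hac : a.toReal < c := by
    have hc : 0 < c := by
      by_contra hc
      rw [ENNReal.ofReal_of_nonpos (le_of_not_gt hc)] at ha
      exact absurd ha (not_lt.2 zero_le)
    exact (ENNReal.lt_ofReal_iff_toReal_lt ha_top).1 ha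
  -- the coupling half-way between `a` and `c` has finite susceptibility and exceeds `a`
  set K : ℝ := (a.toReal + c) / 2 with hKdef
  have hK0 : 0 ≤ K := by have := ENNReal.toReal_nonneg (a := a); rw [hKdef]; linarith
  have hKc : K < c := by rw [hKdef]; linarith
  have haK : a < ENNReal.ofReal K := by
    rw [ENNReal.lt_ofReal_iff_toReal_lt ha_top, hKdef]; linarith
  exact haK.trans_le (ofReal_le_susceptibilityCriticalCoupling hK0 (h K hK0 hKc))

/-- **`K_χ(ν) = ∞` iff the susceptibility is finite at every coupling `K ≥ 0`** (no transition on the `K`-axis).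
[cite: Simon1980CMP, Thm 1.3] -/
theorem susceptibilityCriticalCoupling_eq_top_iff :
    susceptibilityCriticalCoupling ν = ⊤ ↔ ∀ K : ℝ, 0 ≤ K → Summable fun x : Site ν => infTwoPoint K ν 0 x := by
  constructor
  · intro h K hK
    exact summable_infTwoPoint_of_ofReal_lt hK (h ▸ ENNReal.ofReal_lt_top)
  · intro h
    refine ENNReal.eq_top_of_forall_nnreal_le fun r => ?_
    have h1 := ofReal_le_susceptibilityCriticalCoupling (ν := ν) r.coe_nonneg (h r r.coe_nonneg)
    rwa [ENNReal.ofReal_coe_nnreal] at h1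

/-- **Aizenman–Simon: `2β_c(d) ≤ K_χ(d)`** in every dimension `d ≥ 2` — the rotator's susceptibility transition lies
at or beyond twice the Ising critical coupling («`β_c^R ≥ 2β_c^I`», eq. (2)), on the proved sharpness of the Ising
transition (§1). In temperature units `T_χ(J) ≤ J/(2β_c(d)) = ½·T_c^{Ising}(ℤ^d)`. [cite: AizenmanSimon1980RotorIsing, eq. (2)] -/
theorem two_mul_criticalBeta_le_susceptibilityCriticalCoupling {d : ℕ} (hd : 2 ≤ d) :
    ENNReal.ofReal (2 * criticalBeta d) ≤ susceptibilityCriticalCoupling d :=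
  ofReal_le_susceptibilityCriticalCoupling_of_forall_lt fun _ hK0 hK =>
    summable_infTwoPoint_of_lt_two_mul_criticalBeta hd hK0 hK

/-- **`log(1+√2) ≤ K_χ(2)`**: the square-lattice susceptibility transition lies beyond the Aizenman–Simon–Onsager
window (`log(1+√2) ≤ 2β_c(2)`, tree `log_one_add_sqrt_two_le_two_mul_criticalBeta_two`); in temperature units
`T_χ(J) ≤ J/log(1+√2) < 1.1346·J`. [cite: AizenmanSimon1980RotorIsing, eq. (2) (β_c^I = ½ln(1+√2) in d = 2)] -/
theorem log_one_add_sqrt_two_le_susceptibilityCriticalCoupling_two :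
    ENNReal.ofReal (Real.log (1 + Real.sqrt 2)) ≤ susceptibilityCriticalCoupling 2 :=
  (ENNReal.ofReal_le_ofReal log_one_add_sqrt_two_le_two_mul_criticalBeta_two).trans
    (two_mul_criticalBeta_le_susceptibilityCriticalCoupling le_rfl)

/-- `0 < K_χ(2)`. [cite: AizenmanSimon1980RotorIsing, eq. (2)] -/
theorem susceptibilityCriticalCoupling_two_pos : 0 < susceptibilityCriticalCoupling 2 :=
  lt_of_lt_of_le (ENNReal.ofReal_pos.2 two_mul_criticalBeta_two_pos)
    (two_mul_criticalBeta_le_susceptibilityCriticalCoupling le_rfl)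

/-- **Under Fröhlich–Spencer's Theorem C the square-lattice susceptibility transition exists**: `K_χ(2) ≤ K₁ < ∞`
for the threshold `K₁` of the named fact (`χ(K) = ∞` for all `K ≥ K₁`, tree `FrohlichSpencerPowerLawLowerBound.not_summable`);
with §2: `log(1+√2) ≤ K_χ(2) ≤ K₁`, i.e. `J/K₁ ≤ T_χ(J) ≤ J/log(1+√2)`. CONDITIONAL on the named fact (hypothesis).
[cite: FrohlichSpencerKT1981, §1.4 Theorem C (p. 534)] -/
theorem FrohlichSpencerPowerLawLowerBound.susceptibilityCriticalCoupling_two_le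
    (hFS : FrohlichSpencerPowerLawLowerBound) :
    ∃ K₁ : ℝ, 0 < K₁ ∧ susceptibilityCriticalCoupling 2 ≤ ENNReal.ofReal K₁ := by
  obtain ⟨K₁, hK₁, hns⟩ := hFS.not_summable
  exact ⟨K₁, hK₁, susceptibilityCriticalCoupling_le_ofReal_of_not_summable hK₁.le (hns K₁ le_rfl)⟩

/-- Under Theorem C, `K_χ(2) < ∞`: the two-dimensional plane rotator HAS a susceptibility transition at a finite
coupling (a positive temperature `T_χ(J) = J/K_χ(2) > 0`). CONDITIONAL on the named fact.
[cite: FrohlichSpencerKT1981, §1.4 Theorem C (p. 534)] -/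
theorem FrohlichSpencerPowerLawLowerBound.susceptibilityCriticalCoupling_two_lt_top
    (hFS : FrohlichSpencerPowerLawLowerBound) : susceptibilityCriticalCoupling 2 < ⊤ := by
  obtain ⟨K₁, _, hle⟩ := hFS.susceptibilityCriticalCoupling_two_le
  exact hle.trans_lt ENNReal.ofReal_lt_top

end Susceptibility

end PlaneRotator

/-! ## §3 The stiffness transition coupling `K_Υ` of the square lattice, and `K_χ(2) ≤ K_Υ` -/

section Stiffness

open PlaneRotator
open Literature.Barriers.CriticalPhenomena Literature.Barriers.CriticalPhenomena.LongRangeIsing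

variable [MeasurableSpace Circle] [BorelSpace Circle]

/-- **The stiffness transition coupling of the two-dimensional plane rotator**,
`K_Υ := inf {K ≥ 0 : Υ_∞(K) > 0} ∈ [0, ∞]`, where `Υ_∞(K) = liminf_L βΥ_{L+1}(K)` is the infinite-volume reduced
helicity modulus (`torusXYStiffnessLiminf`); `∞` if `Υ_∞` vanishes at every coupling (which the tree does not exclude:
`Υ_∞ > 0` at large `K` is Fröhlich–Spencer-level and is asserted nowhere). In temperature units the stiffness onset is
`T_Υ(J) = J/K_Υ`; the Kosterlitz–Thouless picture identifies `T_Υ` with `T_χ` and with vortex unbinding — NOT used.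
[cite: FisherBarberJasnow1973, §II eq. (2.5) (thermodynamic helicity modulus); Nelson2002Defects, §2.2.2 eqs. (2.44)–(2.47)] -/
def stiffnessCriticalCoupling : ℝ≥0∞ :=
  ⨅ (K : ℝ) (_ : 0 ≤ K ∧ 0 < torusXYStiffnessLiminf K), ENNReal.ofReal K

/-- A coupling with positive infinite-volume stiffness lies above `K_Υ`: `0 ≤ K`, `Υ_∞(K) > 0 ⇒ K_Υ ≤ K`.
[cite: FisherBarberJasnow1973, §II eq. (2.5)] -/
theorem stiffnessCriticalCoupling_le_ofReal {K : ℝ} (hK : 0 ≤ K) (h : 0 < torusXYStiffnessLiminf K) :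
    stiffnessCriticalCoupling ≤ ENNReal.ofReal K :=
  iInf₂_le (f := fun K (_ : 0 ≤ K ∧ 0 < torusXYStiffnessLiminf K) => ENNReal.ofReal K) K ⟨hK, h⟩

/-- **Below `K_Υ` there is no stiffness**: `0 ≤ K`, `K < K_Υ ⇒ Υ_∞(K) = 0` (by definition of the infimum and
`Υ_∞ ≥ 0`). [cite: FisherBarberJasnow1973, §II eq. (2.5)] -/
theorem torusXYStiffnessLiminf_eq_zero_of_ofReal_lt {K : ℝ} (hK : 0 ≤ K)
    (h : ENNReal.ofReal K < stiffnessCriticalCoupling) : torusXYStiffnessLiminf K = 0 := by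
  by_contra hne
  have hpos : 0 < torusXYStiffnessLiminf K := lt_of_le_of_ne (torusXYStiffnessLiminf_nonneg hK) (Ne.symm hne)
  exact absurd h (not_lt.2 (stiffnessCriticalCoupling_le_ofReal hK hpos))

/-- If `Υ_∞` vanishes on a whole interval `0 ≤ K < c` then `c ≤ K_Υ`. [cite: FisherBarberJasnow1973, §II eq. (2.5)] -/
theorem ofReal_le_stiffnessCriticalCoupling_of_forall_lt {c : ℝ}
    (h : ∀ K : ℝ, 0 ≤ K → K < c → torusXYStiffnessLiminf K = 0) :
    ENNReal.ofReal c ≤ stiffnessCriticalCoupling := by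
  refine le_iInf₂ fun K hK => ENNReal.ofReal_le_ofReal ?_
  by_contra hlt
  exact hK.2.ne' (h K hK.1 (lt_of_not_ge hlt))

/-- **`K_χ(2) ≤ K_Υ` — the stiffness onset lies at or beyond the susceptibility transition** (`T_Υ ≤ T_χ`, the
structural half of `T_Υ = T_χ`): wherever `Υ_∞(K) > 0` the free susceptibility is infinite (Simon–Lieb, tree
`not_summable_infTwoPoint_of_torusXYStiffnessLiminf_pos`), so every such coupling bounds `K_χ(2)` from above.
[cite: Simon1980CMP, Thm 1.3; Lieb1980, p. 128 (boxes)] -/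
theorem susceptibilityCriticalCoupling_two_le_stiffnessCriticalCoupling :
    susceptibilityCriticalCoupling 2 ≤ stiffnessCriticalCoupling :=
  le_iInf₂ fun _ hK => susceptibilityCriticalCoupling_le_ofReal_of_not_summable hK.1
    (not_summable_infTwoPoint_of_torusXYStiffnessLiminf_pos hK.1 hK.2)

/-- **No stiffness below the susceptibility transition**: `0 ≤ K < K_χ(2) ⇒ Υ_∞(K) = 0` (`χ(K) < ∞` there, and a
finite susceptibility kills `Υ_∞`, tree `torusXYStiffnessLiminf_eq_zero_of_summable`).
[cite: Simon1980CMP, Thm 1.3; Lieb1980, p. 128 (boxes)] -/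
theorem torusXYStiffnessLiminf_eq_zero_of_ofReal_lt_susceptibilityCriticalCoupling {K : ℝ} (hK : 0 ≤ K)
    (h : ENNReal.ofReal K < susceptibilityCriticalCoupling 2) : torusXYStiffnessLiminf K = 0 :=
  torusXYStiffnessLiminf_eq_zero_of_summable hK (summable_infTwoPoint_of_ofReal_lt hK h)

/-- **`2β_c(2) ≤ K_Υ`**: no stiffness transition of the comparison model inside Aizenman–Simon's window
(`T_Υ(J) ≤ J/(2β_c(2))`). [cite: AizenmanSimon1980RotorIsing, eq. (2); FisherBarberJasnow1973, §II eq. (2.5)] -/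
theorem two_mul_criticalBeta_two_le_stiffnessCriticalCoupling :
    ENNReal.ofReal (2 * criticalBeta 2) ≤ stiffnessCriticalCoupling :=
  (two_mul_criticalBeta_le_susceptibilityCriticalCoupling le_rfl).trans
    susceptibilityCriticalCoupling_two_le_stiffnessCriticalCoupling

/-- **`log(1+√2) ≤ K_Υ`** (`T_Υ(J) ≤ J/log(1+√2) < 1.1346·J`). [cite: AizenmanSimon1980RotorIsing, eq. (2) (β_c^I = ½ln(1+√2) in d = 2); FisherBarberJasnow1973, §II eq. (2.5)] -/
theorem log_one_add_sqrt_two_le_stiffnessCriticalCoupling :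
    ENNReal.ofReal (Real.log (1 + Real.sqrt 2)) ≤ stiffnessCriticalCoupling :=
  log_one_add_sqrt_two_le_susceptibilityCriticalCoupling_two.trans
    susceptibilityCriticalCoupling_two_le_stiffnessCriticalCoupling

/-- `0 < K_Υ` (from `0 < 2β_c(2) ≤ K_χ(2) ≤ K_Υ`). [cite: AizenmanSimon1980RotorIsing, eq. (2)] -/
theorem stiffnessCriticalCoupling_pos : 0 < stiffnessCriticalCoupling :=
  susceptibilityCriticalCoupling_two_pos.trans_le susceptibilityCriticalCoupling_two_le_stiffnessCriticalCoupling

/-- **`K_Υ = ∞` iff `Υ_∞(K) = 0` for every `K ≥ 0`** (no stiffness transition on the `K`-axis) — the alternative the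
tree cannot exclude without Fröhlich–Spencer-type input on the stiffness itself.
[cite: FisherBarberJasnow1973, §II eq. (2.5); FrohlichSpencerKT1981, §1.4 (existence of the low-temperature phase)] -/
theorem stiffnessCriticalCoupling_eq_top_iff :
    stiffnessCriticalCoupling = ⊤ ↔ ∀ K : ℝ, 0 ≤ K → torusXYStiffnessLiminf K = 0 := by
  constructor
  · intro h K hK
    exact torusXYStiffnessLiminf_eq_zero_of_ofReal_lt hK (h ▸ ENNReal.ofReal_lt_top)
  · intro h
    unfold stiffnessCriticalCoupling
    refine iInf_eq_top.2 fun K => iInf_eq_top.2 fun hK => ?_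
    exact absurd (h K hK.1) hK.2.ne'

/-- **A stiffness profile positive below `T_c` puts `K_Υ ≤ J/T_c`** (`T_c ≤ T_Υ(J) := J/K_Υ`): if `Υ_∞(J/T) > 0` for
all `0 < T < T_c` (`J, T_c > 0`) then `K_Υ ≤ J/T_c` — every `J/T` with `T < T_c` bounds `K_Υ`, and `J/T ↓ J/T_c`.
With `2β_c(2) ≤ K_Υ` this is the tree's `kt_le_div_two_mul_criticalBeta_two_of_liminf_pos_below` again, now through
the object `K_Υ`. [cite: Nelson2002Defects, §2.2.2 eqs. (2.44)–(2.47); FisherBarberJasnow1973, §II eq. (2.5)] -/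
theorem stiffnessCriticalCoupling_le_of_liminf_pos_below {J Tc : ℝ} (hJ : 0 < J) (hTc : 0 < Tc)
    (h : ∀ ⦃T : ℝ⦄, 0 < T → T < Tc → 0 < torusXYStiffnessLiminf (J / T)) :
    stiffnessCriticalCoupling ≤ ENNReal.ofReal (J / Tc) := by
  refine le_of_forall_gt_imp_ge_of_dense fun c hc => ?_
  rcases eq_or_ne c ⊤ with rfl | hc_top
  · exact le_top
  -- `c = ofReal c'` with `J/T_c < c'`; the temperature `T = J/c' < T_c` has `Υ_∞(J/T) > 0` and `J/T = c'`
  have hc' : J / Tc < c.toReal := (ENNReal.ofReal_lt_iff_lt_toReal (div_pos hJ hTc).le hc_top).1 hc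
  have hc'pos : 0 < c.toReal := (div_pos hJ hTc).trans hc'
  have hT : 0 < J / c.toReal := div_pos hJ hc'pos
  have hTTc : J / c.toReal < Tc := by
    rw [div_lt_iff₀ hc'pos]
    rw [div_lt_iff₀ hTc] at hc'
    linarith
  have hK : stiffnessCriticalCoupling ≤ ENNReal.ofReal (J / (J / c.toReal)) :=
    stiffnessCriticalCoupling_le_ofReal (div_pos hJ hT).le (h hT hTTc)
  rwa [div_div_cancel₀ hJ.ne', ENNReal.ofReal_toReal hc_top] at hK

/-- Under the K2 hypothesis on `Υ_∞` (`NelsonKosterlitzOnLiminf J T_c`: `Υ_∞(J/T) ≥ 2/π` on `(0, T_c)`, a PREDICATE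
consumed as hypothesis): `K_Υ ≤ J/T_c`, i.e. `T_c ≤ T_Υ(J)`. [cite: Nelson2002Defects, §2.2.2 eqs. (2.44)–(2.47) (stability inequality, consumed as hypothesis)] -/
theorem NelsonKosterlitzOnLiminf.stiffnessCriticalCoupling_le {J Tc : ℝ} (hNK : NelsonKosterlitzOnLiminf J Tc)
    (hJ : 0 < J) (hTc : 0 < Tc) : stiffnessCriticalCoupling ≤ ENNReal.ofReal (J / Tc) :=
  stiffnessCriticalCoupling_le_of_liminf_pos_below hJ hTc fun _ hT hTTc =>
    lt_of_lt_of_le (by positivity) (nelsonKosterlitzOnLiminf_iff.1 hNK hT hTTc)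

end Stiffness

/-! ## §4 The layered stack: `K_χ^{3D}(Δ) ≤ K_χ(2)`, antitone in `Δ`, `→ K_χ(2)` as `Δ → 0⁺` -/

namespace PlaneRotator

section Layered

open Literature.Barriers.CriticalPhenomena Literature.Barriers.CriticalPhenomena.LongRangeIsing

variable [MeasurableSpace Circle] [BorelSpace Circle]

/-- **The susceptibility transition coupling of the layered stack at anisotropy `Δ = J⊥/J∥`**,
`K_χ^{3D}(Δ) := sup {K ≥ 0 : ∑_{z ∈ ℤ³} G^{3D}_{(K∥, K⊥) = (K, ΔK)}(0, z) < ∞} ∈ [0, ∞]` (in-plane reduced coupling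
`K = βJ∥`; `infTwoPointLayered 1 K (ΔK)`); in temperature units `T_χ^{3D}(J∥, ΔJ∥) = J∥/K_χ^{3D}(Δ)`. Liu–Stanley's
`T_c(ε)` of the layers `(J, J, εJ)` for the susceptibility transition of the classical layered XY model.
[cite: LiuStanley1972, p. 272 (T_c(ε) of the layers (J, J, εJ)); Simon1980CMP, Thm 1.3] -/
def layeredSusceptibilityCriticalCoupling (Δ : ℝ) : ℝ≥0∞ :=
  ⨆ (K : ℝ) (_ : 0 ≤ K ∧ Summable fun z : Site 3 => infTwoPointLayered 1 K (Δ * K) 0 z), ENNReal.ofReal K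

/-- Every in-plane coupling with finite stack susceptibility lies below `K_χ^{3D}(Δ)`.
[cite: LiuStanley1972, p. 272; Simon1980CMP, Thm 1.3] -/
theorem ofReal_le_layeredSusceptibilityCriticalCoupling {Δ K : ℝ} (hK : 0 ≤ K)
    (hG : Summable fun z : Site 3 => infTwoPointLayered 1 K (Δ * K) 0 z) :
    ENNReal.ofReal K ≤ layeredSusceptibilityCriticalCoupling Δ :=
  le_iSup_of_le (f := fun K : ℝ => ⨆ (_ : 0 ≤ K ∧ Summable fun z : Site 3 => infTwoPointLayered 1 K (Δ * K) 0 z),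
    ENNReal.ofReal K) K (le_iSup (fun _ : 0 ≤ K ∧ Summable fun z : Site 3 => infTwoPointLayered 1 K (Δ * K) 0 z =>
      ENNReal.ofReal K) ⟨hK, hG⟩)

/-- **Below `K_χ^{3D}(Δ)` the stack susceptibility is finite** (`Δ ≥ 0`; sharpness, lower side — the stack's
finite-susceptibility phase is a down-set in both couplings, Griffiths–Ginibre, tree `summable_layered_of_mul_le`).
[cite: Ginibre1970, Prop. 3 with Example 4 (plane rotators); LiuStanley1972, p. 272] -/
theorem summable_layered_of_ofReal_lt {Δ K : ℝ} (hΔ : 0 ≤ Δ) (hK : 0 ≤ K)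
    (h : ENNReal.ofReal K < layeredSusceptibilityCriticalCoupling Δ) :
    Summable fun z : Site 3 => infTwoPointLayered 1 K (Δ * K) 0 z := by
  unfold layeredSusceptibilityCriticalCoupling at h
  obtain ⟨K', hK'⟩ := lt_iSup_iff.1 h
  obtain ⟨⟨hK'0, hG'⟩, hlt⟩ := lt_iSup_iff.1 hK'
  have hKK' : K < K' := (ENNReal.ofReal_lt_ofReal_iff_of_nonneg hK).1 hlt
  exact summable_layered_of_mul_le zero_le_one hK (mul_nonneg hΔ hK) (by rw [one_mul]; exact hKK'.le)
    (by rw [one_mul]; exact mul_le_mul_of_nonneg_left hKK'.le hΔ) hG'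

/-- **Above `K_χ^{3D}(Δ)` the stack susceptibility is infinite.** [cite: Ginibre1970, Prop. 3 with Example 4 (plane rotators); LiuStanley1972, p. 272] -/
theorem not_summable_layered_of_lt_ofReal {Δ K : ℝ} (h : layeredSusceptibilityCriticalCoupling Δ < ENNReal.ofReal K) :
    ¬ Summable fun z : Site 3 => infTwoPointLayered 1 K (Δ * K) 0 z := by
  intro hG
  by_cases hK : 0 ≤ K
  · exact absurd h (not_lt.2 (ofReal_le_layeredSusceptibilityCriticalCoupling hK hG))
  · rw [ENNReal.ofReal_of_nonpos (le_of_not_ge hK)] at h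
    exact absurd h (not_lt.2 zero_le)

/-- An in-plane coupling with infinite stack susceptibility lies above `K_χ^{3D}(Δ)` (`Δ ≥ 0`).
[cite: Ginibre1970, Prop. 3 with Example 4 (plane rotators); LiuStanley1972, p. 272] -/
theorem layeredSusceptibilityCriticalCoupling_le_ofReal_of_not_summable {Δ K : ℝ} (hΔ : 0 ≤ Δ) (hK : 0 ≤ K)
    (h : ¬ Summable fun z : Site 3 => infTwoPointLayered 1 K (Δ * K) 0 z) :
    layeredSusceptibilityCriticalCoupling Δ ≤ ENNReal.ofReal K := by
  refine iSup₂_le fun K' hK' => ENNReal.ofReal_le_ofReal ?_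
  by_contra hlt
  have hKK' : K ≤ K' := le_of_not_ge hlt
  exact h (summable_layered_of_mul_le zero_le_one hK (mul_nonneg hΔ hK) (by rw [one_mul]; exact hKK')
    (by rw [one_mul]; exact mul_le_mul_of_nonneg_left hKK' hΔ) hK'.2)

/-- **A layer sits below the stack: `K_χ^{3D}(Δ) ≤ K_χ(2)` for every `Δ ≥ 0`** — interlayer coupling cannot lower
the susceptibility transition temperature, `T_χ^{3D}(J∥, ΔJ∥) ≥ T_χ^{2D}(J∥)` (tree
`summable_layer_of_summable_layered`). [cite: Ginibre1970, Prop. 3 with Example 4 (plane rotators); LiuStanley1972, p. 272 (T_c(ε) ≥ T_c(0))] -/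
theorem layeredSusceptibilityCriticalCoupling_le {Δ : ℝ} (hΔ : 0 ≤ Δ) :
    layeredSusceptibilityCriticalCoupling Δ ≤ susceptibilityCriticalCoupling 2 := by
  refine iSup₂_le fun K hK => ?_
  have h := summable_layer_of_summable_layered zero_le_one hK.1 (mul_nonneg hΔ hK.1) hK.2
  rw [one_mul] at h
  exact ofReal_le_susceptibilityCriticalCoupling hK.1 h

/-- **`K_χ^{3D}` is antitone in the anisotropy**: `0 ≤ Δ ≤ Δ' ⇒ K_χ^{3D}(Δ') ≤ K_χ^{3D}(Δ)` — a stronger interlayer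
coupling can only raise the transition temperature (Griffiths–Ginibre).
[cite: Ginibre1970, Prop. 3 with Example 4 (plane rotators); LiuStanley1972, p. 272] -/
theorem layeredSusceptibilityCriticalCoupling_antitoneOn :
    AntitoneOn layeredSusceptibilityCriticalCoupling (Set.Ici 0) := by
  intro Δ hΔ Δ' _ hΔΔ'
  refine iSup₂_le fun K hK => ofReal_le_layeredSusceptibilityCriticalCoupling hK.1 ?_
  exact summable_layered_of_mul_le zero_le_one hK.1 (mul_nonneg hΔ hK.1) (by rw [one_mul])
    (by rw [one_mul]; exact mul_le_mul_of_nonneg_right hΔΔ' hK.1) hK.2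

/-- **The decoupled stack is the layer: `K_χ^{3D}(0) = K_χ(2)`** (at `Δ = 0` the stack's free state is a product of
layers; tree `summable_layered_of_summable_layer` at `βJ⊥ = 0 ≤ δ` and `summable_layer_of_summable_layered`).
[cite: LiuStanley1972, p. 272 (ε = 0); Simon1980CMP, Thm 1.3] -/
theorem layeredSusceptibilityCriticalCoupling_zero :
    layeredSusceptibilityCriticalCoupling 0 = susceptibilityCriticalCoupling 2 := by
  refine le_antisymm (layeredSusceptibilityCriticalCoupling_le le_rfl) (iSup₂_le fun K hK => ?_)
  obtain ⟨δ, hδ, h⟩ := summable_layered_of_summable_layer hK.1 hK.2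
  refine ofReal_le_layeredSusceptibilityCriticalCoupling hK.1 (h zero_le_one hK.1 ?_ (by rw [one_mul]) ?_)
  · rw [zero_mul]
  · rw [zero_mul, mul_zero]; exact hδ.le

/-- **The single layer's phase survives weak interlayer coupling, objectwise**: if `χ^{2D}(K₀) < ∞` (`K₀ ≥ 0`) then
`K₀ ≤ K_χ^{3D}(Δ)` for all sufficiently small `Δ > 0` (indeed for `0 ≤ Δ` with `ΔK₀ ≤ δ(K₀)` of
`summable_layered_of_summable_layer`). [cite: LiuStanley1972, p. 272 (T_c(ε) → T_c(0)); Simon1980CMP, Thm 1.3; Lieb1980, p. 128 (boxes)] -/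
theorem eventually_ofReal_le_layeredSusceptibilityCriticalCoupling {K₀ : ℝ} (hK0 : 0 ≤ K₀)
    (hG : Summable fun x : Site 2 => infTwoPoint K₀ 2 0 x) :
    ∀ᶠ Δ : ℝ in 𝓝[>] 0, ENNReal.ofReal K₀ ≤ layeredSusceptibilityCriticalCoupling Δ := by
  obtain ⟨δ, hδ, h⟩ := summable_layered_of_summable_layer hK0 hG
  have hsmall : ∀ᶠ Δ : ℝ in 𝓝 (0 : ℝ), Δ * K₀ < δ := by
    have ht : Tendsto (fun Δ : ℝ => Δ * K₀) (𝓝 0) (𝓝 0) := by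
      have h0 := (tendsto_id (x := 𝓝 (0 : ℝ))).mul_const K₀
      simpa using h0
    exact ht.eventually (gt_mem_nhds hδ)
  filter_upwards [hsmall.filter_mono nhdsWithin_le_nhds, self_mem_nhdsWithin] with Δ hΔδ hΔpos
  have hΔ : 0 ≤ Δ := le_of_lt hΔpos
  exact ofReal_le_layeredSusceptibilityCriticalCoupling hK0
    (h zero_le_one hK0 (mul_nonneg hΔ hK0) (by rw [one_mul]) (by rw [one_mul]; exact hΔδ.le))

/-- **Liu–Stanley's limit for the susceptibility transition, as a limit of numbers:
`K_χ^{3D}(Δ) → K_χ(2)` as `Δ → 0⁺`** — `T_χ^{3D}(J∥, ΔJ∥) ↓ T_χ^{2D}(J∥)`: from below by the single layer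
(`K_χ^{3D}(Δ) ≤ K_χ(2)` for every `Δ`), from above because every coupling of the layer's high-temperature phase is
eventually in the stack's (`eventually_ofReal_le_layeredSusceptibilityCriticalCoupling`). Holds verbatim when
`K_χ(2) = ∞`. [cite: LiuStanley1972, p. 272 (T_c(ε) → T_c^{2D} as ε → 0); Simon1980CMP, Thm 1.3; Lieb1980, p. 128 (boxes)] -/
theorem tendsto_layeredSusceptibilityCriticalCoupling_zero :
    Tendsto layeredSusceptibilityCriticalCoupling (𝓝[>] 0) (𝓝 (susceptibilityCriticalCoupling 2)) := by
  refine tendsto_order.2 ⟨fun a ha => ?_, fun b hb => ?_⟩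
  · -- lower: `a < K_χ(2)` is exceeded by some `ofReal K₀` with `χ^{2D}(K₀) < ∞`
    unfold susceptibilityCriticalCoupling at ha
    obtain ⟨K₀, hK₀⟩ := lt_iSup_iff.1 ha
    obtain ⟨⟨hK₀0, hG⟩, hlt⟩ := lt_iSup_iff.1 hK₀
    filter_upwards [eventually_ofReal_le_layeredSusceptibilityCriticalCoupling hK₀0 hG] with Δ hΔ
    exact hlt.trans_le hΔ
  · -- upper: `K_χ^{3D}(Δ) ≤ K_χ(2) < b` for every `Δ > 0`
    filter_upwards [self_mem_nhdsWithin] with Δ hΔ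
    exact (layeredSusceptibilityCriticalCoupling_le (le_of_lt hΔ)).trans_lt hb

/-- The same as a supremum: **`sup_{Δ > 0} K_χ^{3D}(Δ) = K_χ(2)`** (antitone and bounded by the layer; the weak-coupling
end exhausts the layer's phase). [cite: LiuStanley1972, p. 272; Simon1980CMP, Thm 1.3] -/
theorem iSup_layeredSusceptibilityCriticalCoupling_pos :
    ⨆ (Δ : ℝ) (_ : 0 < Δ), layeredSusceptibilityCriticalCoupling Δ = susceptibilityCriticalCoupling 2 := by
  refine le_antisymm (iSup₂_le fun Δ hΔ => layeredSusceptibilityCriticalCoupling_le hΔ.le) ?_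
  refine le_of_forall_lt fun a ha => ?_
  have hev := (tendsto_order.1 tendsto_layeredSusceptibilityCriticalCoupling_zero).1 a ha
  obtain ⟨Δ, hΔ, hΔpos⟩ := (hev.and self_mem_nhdsWithin).exists
  exact hΔ.trans_le (le_iSup₂ (f := fun Δ (_ : 0 < Δ) => layeredSusceptibilityCriticalCoupling Δ) Δ hΔpos)

/-- **Lieb's star region lies below `K_χ^{3D}(Δ)`**: every in-plane coupling `K ≥ 0` whose couplings `(K, ΔK)`
satisfy Lieb's star `4u(K) + 2u(ΔK) < 1`, `u(x) = x/√(x² + 4)` (Amos' bound for `I₁/I₀`; tree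
`summable_layered_of_amos_star_lt_one`, the closed-form DISORDER REGION of record) has finite stack susceptibility,
hence `K ≤ K_χ^{3D}(Δ)` — an explicit floor under the stack's transition coupling at every anisotropy `Δ ≥ 0` (in
temperature units: the region is an upper bound on `T_χ^{3D}`). [cite: Lieb1980, Theorem 4 (the star); Simon1980CMP, Thm 1.3; LiuStanley1972, p. 272] -/
theorem ofReal_le_layeredSusceptibilityCriticalCoupling_of_amos_star_lt_one {Δ K : ℝ} (hΔ : 0 ≤ Δ) (hK : 0 ≤ K)
    (hm : 4 * (K / Real.sqrt (K ^ 2 + 4)) + 2 * (Δ * K / Real.sqrt ((Δ * K) ^ 2 + 4)) < 1) :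
    ENNReal.ofReal K ≤ layeredSusceptibilityCriticalCoupling Δ :=
  ofReal_le_layeredSusceptibilityCriticalCoupling hK
    (summable_layered_of_amos_star_lt_one zero_le_one hK (mul_nonneg hΔ hK) (by rw [one_mul]) (by rw [one_mul]) hm)

/-! ### The isotropic endpoint `Δ = 1` -/

/-- At `J⊥ = J∥` the layered box two-point function is the isotropic one on `ℤ³` (`layeredXYCoupling_self`).
[cite: LiuStanley1972, p. 272 (layers (J, J, εJ), ε = 1)] -/
theorem volTwoPointLayered_isotropic (K : ℝ) (Λ : Finset (Site 3)) (x y : Site 3) :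
    volTwoPointLayered 1 K K Λ x y = volTwoPoint K 3 Λ x y := by
  unfold volTwoPointLayered volTwoPoint
  simp only [layeredXYCoupling_self, one_mul]

/-- At `J⊥ = J∥` the layered infinite-volume two-point function is the isotropic `G_K` on `ℤ³`.
[cite: LiuStanley1972, p. 272 (layers (J, J, εJ), ε = 1); Simon1980CMP, Thm 1.3] -/
theorem infTwoPointLayered_isotropic (K : ℝ) (x y : Site 3) :
    infTwoPointLayered 1 K K x y = infTwoPoint K 3 x y := by
  unfold infTwoPointLayered infTwoPoint
  simp only [volTwoPointLayered_isotropic]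

/-- **The isotropic endpoint: `K_χ^{3D}(1) = K_χ(3)`**, the susceptibility transition coupling of the classical XY
model on `ℤ³`. [cite: LiuStanley1972, p. 272 (ε = 1); Simon1980CMP, Thm 1.3] -/
theorem layeredSusceptibilityCriticalCoupling_one :
    layeredSusceptibilityCriticalCoupling 1 = susceptibilityCriticalCoupling 3 := by
  unfold layeredSusceptibilityCriticalCoupling susceptibilityCriticalCoupling
  simp only [one_mul, infTwoPointLayered_isotropic]

/-- **`2β_c(3) ≤ K_χ^{3D}(1)`**: the isotropic three-dimensional XY model has finite susceptibility for
`βJ < 2β_c(3)` (Aizenman–Simon in `d = 3`, §2) — `T_χ^{3D-XY}(J, J) ≤ ½·T_c^{Ising}(ℤ³)`; `β_c(3)` carries no kernel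
number. [cite: AizenmanSimon1980RotorIsing, eq. (2) (any dimension); LiuStanley1972, p. 272] -/
theorem two_mul_criticalBeta_three_le_layeredSusceptibilityCriticalCoupling_one :
    ENNReal.ofReal (2 * criticalBeta 3) ≤ layeredSusceptibilityCriticalCoupling 1 := by
  rw [layeredSusceptibilityCriticalCoupling_one]
  exact two_mul_criticalBeta_le_susceptibilityCriticalCoupling (by norm_num)

/-- **The layered window in one line**: for every anisotropy `0 ≤ Δ ≤ 1`,
`2β_c(3) ≤ K_χ^{3D}(1) ≤ K_χ^{3D}(Δ) ≤ K_χ(2) ≤ K_Υ` — the stack's susceptibility transition coupling is squeezed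
between the isotropic three-dimensional one and the single layer's, which in turn lies below the layer's stiffness
onset. [cite: LiuStanley1972, p. 272; AizenmanSimon1980RotorIsing, eq. (2); Simon1980CMP, Thm 1.3] -/
theorem layeredSusceptibilityCriticalCoupling_mem_Icc {Δ : ℝ} (hΔ0 : 0 ≤ Δ) (hΔ1 : Δ ≤ 1) :
    layeredSusceptibilityCriticalCoupling 1 ≤ layeredSusceptibilityCriticalCoupling Δ ∧
      layeredSusceptibilityCriticalCoupling Δ ≤ susceptibilityCriticalCoupling 2 :=
  ⟨layeredSusceptibilityCriticalCoupling_antitoneOn (Set.mem_Ici.2 hΔ0) (Set.mem_Ici.2 zero_le_one) hΔ1,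
    layeredSusceptibilityCriticalCoupling_le hΔ0⟩

end Layered

/-! ### Ceilings from the infrared bound: `K_χ^{3D}(Δ) ≤ C(Δ)` (Fröhlich–Simon–Spencer / FILS / Kennedy–Lieb–Shastry)

The torus objects `AnisotropicRotator.plateau` / `corr` and the tree's bridge `not_summable_layered_of_plateau_ge`
(torus long-range order ⇒ infinite free susceptibility) live at the tree's canonical Borel structure on `Circle`
(`GrassmannIntegral.instMeasurableSpace`), so the ceilings below are stated at that instance (no local
`[MeasurableSpace Circle]` binder), like `LayeredPlaneRotatorSusceptibilityDichotomy` §4. -/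

section InfraredCeilings

/-- From an eventual torus plateau floor (the shape of the tree's infrared-bound theorems: all large even `L ≥ 4`)
to an infinite free susceptibility of the stack at couplings `(1, K, K⊥)` (tree `not_summable_layered_of_plateau_ge`:
torus long-range order forces `∑_z G^{3D,free}(0,z) = ∞`). [cite: FriedliVelenikSMLS2017, Thm 10.25 with (10.39)–(10.42) (the plateau); Simon1980CMP, Thm 1.3] -/
private theorem not_summable_layered_of_plateau_floor {K Kz δ : ℝ} (hK : 0 ≤ K) (hz : 0 ≤ Kz) (hδ : 0 < δ)
    (h : ∃ L₀ : ℕ, ∀ (L : ℕ) [NeZero L], L₀ ≤ L → Even L → 4 ≤ L →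
      δ ≤ AnisotropicRotator.plateau L (AnisotropicRotator.layeredCoupling K Kz)) :
    ¬ Summable fun z : Site 3 => infTwoPointLayered 1 K Kz 0 z := by
  obtain ⟨L₀, hL₀⟩ := h
  refine AnisotropicRotator.not_summable_layered_of_plateau_ge zero_le_one hK hz hδ fun L₁ => ?_
  haveI : NeZero (2 * (max L₀ L₁ + 2)) := ⟨by omega⟩
  refine ⟨2 * (max L₀ L₁ + 2), inferInstance, by omega, ?_⟩
  have h := hL₀ (2 * (max L₀ L₁ + 2)) (by omega) ⟨max L₀ L₁ + 2, by ring⟩ (by omega)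
  simpa only [one_mul] using h

/-- A real threshold above which the stack's free susceptibility is infinite is a ceiling for `K_χ^{3D}(Δ)` (density
of the reals in `[0, ∞]`). [cite: Simon1980CMP, Thm 1.3; LiuStanley1972, p. 272] -/
private theorem layeredSusceptibilityCriticalCoupling_le_of_forall_gt {Δ c : ℝ} (hΔ : 0 ≤ Δ) (hc : 0 ≤ c)
    (h : ∀ K : ℝ, c < K → ¬ Summable fun z : Site 3 => infTwoPointLayered 1 K (Δ * K) 0 z) :
    layeredSusceptibilityCriticalCoupling Δ ≤ ENNReal.ofReal c := by
  refine le_of_forall_gt_imp_ge_of_dense fun a ha => ?_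
  rcases eq_or_ne a ⊤ with rfl | ha_top
  · exact le_top
  have hca : c < a.toReal := (ENNReal.ofReal_lt_iff_lt_toReal hc ha_top).1 ha
  have hle := layeredSusceptibilityCriticalCoupling_le_ofReal_of_not_summable hΔ (hc.trans hca.le) (h _ hca)
  rwa [ENNReal.ofReal_toReal ha_top] at hle

/-- `0.49 ≤ C(Δ)` for `0 < Δ ≤ 1` (`C` antitone, `C(1) = R(3) ≥ 0.4902`, Watson's constant certified in the tree).
[cite: FILS1978, eq. (4.7); Guttmann2010, §2.1 (Watson's integral)] -/
private theorem decimal_le_klsConstant {Δ : ℝ} (hΔ0 : 0 < Δ) (hΔ1 : Δ ≤ 1) :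
    (4902 / 10000 : ℝ) ≤ AnisotropicRotator.klsConstant Δ := by
  have h1 : (4902 / 10000 : ℝ) ≤ AnisotropicRotator.klsConstant 1 := by
    rw [AnisotropicRotator.klsConstant_one]; exact latticeGreen_three_zero_mem_Icc.1
  exact h1.trans (AnisotropicRotator.klsConstant_antitone hΔ0 hΔ1)

/-- **The infrared-bound ceiling: `K_χ^{3D}(Δ) ≤ C(Δ)` for every anisotropy `0 < Δ ≤ 1`**, `C(Δ) = (2π)⁻³∫d³q/E^Δ_q`
the FILS / Kennedy–Lieb–Shastry constant (tree `AnisotropicRotator.klsConstant`): at in-plane coupling `K > C(Δ)` the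
layered stack on large even tori has plateau `≥ 1 − C(Δ)/K − ε > 0` (tree `layered_longRangeOrder_infraredBound`,
reflection positivity + Gaussian domination), and torus long-range order forces an infinite free susceptibility. In
temperature units **`T_χ^{3D}(J∥, ΔJ∥) ≥ J∥/C(Δ)`**. Together with Lieb's star floor this BRACKETS the stack's
susceptibility transition coupling between two kernel quantities at every `0 < Δ ≤ 1`.
[cite: FILS1978, Thm. 4.7 with (4.7)–(4.10); KLS1988JSP, eqs. (5)–(7); Simon1980CMP, Thm 1.3] -/
theorem layeredSusceptibilityCriticalCoupling_le_klsConstant {Δ : ℝ} (hΔ0 : 0 < Δ) (hΔ1 : Δ ≤ 1) :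
    layeredSusceptibilityCriticalCoupling Δ ≤ ENNReal.ofReal (AnisotropicRotator.klsConstant Δ) := by
  have hC0 : 0 ≤ AnisotropicRotator.klsConstant Δ := le_trans (by norm_num) (decimal_le_klsConstant hΔ0 hΔ1)
  refine layeredSusceptibilityCriticalCoupling_le_of_forall_gt hΔ0.le hC0 fun K hK => ?_
  have hK0 : 0 < K := hC0.trans_lt hK
  have hlt : AnisotropicRotator.klsConstant Δ / K < 1 := (div_lt_one hK0).2 hK
  have hδ : 0 < (1 - AnisotropicRotator.klsConstant Δ / K) / 2 := by linarith
  refine not_summable_layered_of_plateau_floor hK0.le (mul_nonneg hΔ0.le hK0.le) hδ ?_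
  obtain ⟨L₀, hL₀⟩ := AnisotropicRotator.layered_longRangeOrder_infraredBound hK0 (mul_pos hΔ0 hK0) hδ
  refine ⟨L₀, fun L _ hL hLe hL4 => ?_⟩
  have h := hL₀ L hL hLe hL4
  rw [mul_div_cancel_right₀ Δ hK0.ne'] at h
  linarith

/-- **Closed form of the ceiling: `K_χ^{3D}(Δ) ≤ 1 + ln(1/Δ)/(2π)`** for `0 < Δ ≤ 1` (tree `klsConstant_le_log`, slope
exact) — `T_χ^{3D}(J∥, ΔJ∥) ≥ J∥/(1 + ln(J∥/J⊥)/(2π))`, the Kennedy–Lieb–Shastry logarithm as a floor under the stack's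
transition temperature at every anisotropy. [cite: KLS1988JSP, eq. (7); FILS1978, (4.7)] -/
theorem layeredSusceptibilityCriticalCoupling_le_log {Δ : ℝ} (hΔ0 : 0 < Δ) (hΔ1 : Δ ≤ 1) :
    layeredSusceptibilityCriticalCoupling Δ ≤ ENNReal.ofReal (1 + Real.log (1 / Δ) / (2 * Real.pi)) :=
  (layeredSusceptibilityCriticalCoupling_le_klsConstant hΔ0 hΔ1).trans
    (ENNReal.ofReal_le_ofReal (AnisotropicRotator.klsConstant_le_log hΔ0 hΔ1))

/-- **Kernel decimal at `Δ ≥ ½`: `K_χ^{3D}(Δ) ≤ 0.627`** (`C(½) ≤ 627/1000`, tree `klsConstant_half_le`, certified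
quadrature; `K_χ^{3D}` antitone in `Δ`) — `T_χ^{3D}(J∥, J⊥) ≥ J∥/0.627 > 1.59·J∥` whenever `J⊥ ≥ ½J∥`; in particular
for `J⊥ ≥ ½J∥` the stack's free susceptibility is infinite at the two-dimensional Nelson–Kosterlitz coupling
`K = 2/π > 0.627`. [cite: KLS1988JSP, eq. (7); FILS1978, Thm. 4.7] -/
theorem layeredSusceptibilityCriticalCoupling_le_of_half_le {Δ : ℝ} (hΔ : 1 / 2 ≤ Δ) :
    layeredSusceptibilityCriticalCoupling Δ ≤ ENNReal.ofReal (627 / 1000) :=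
  (layeredSusceptibilityCriticalCoupling_antitoneOn (Set.mem_Ici.2 (by norm_num : (0 : ℝ) ≤ 1 / 2))
      (Set.mem_Ici.2 (le_trans (by norm_num) hΔ)) hΔ).trans
    ((layeredSusceptibilityCriticalCoupling_le_klsConstant (by norm_num) (by norm_num)).trans
      (ENNReal.ofReal_le_ofReal AnisotropicRotator.klsConstant_half_le))

/-- **The isotropic ceiling with Watson's constant: `K_χ(3) ≤ R(3) ≤ 0.5094`** — the classical XY model on `ℤ³` has
infinite free susceptibility for every `K > latticeGreen 0` (Fröhlich–Simon–Spencer; `C(1) = R(3)`, tree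
`klsConstant_one`, `latticeGreen_three_zero_mem_Icc`): `T_χ^{XY}(ℤ³) ≥ J/0.5094 > 1.963·J`.
[cite: FriedliVelenikSMLS2017, Thm 10.25 with (10.41)–(10.42); Guttmann2010, §2.1 (Watson's integral)] -/
theorem susceptibilityCriticalCoupling_three_le :
    susceptibilityCriticalCoupling 3 ≤ ENNReal.ofReal (5094 / 10000) := by
  rw [← layeredSusceptibilityCriticalCoupling_one]
  refine (layeredSusceptibilityCriticalCoupling_le_klsConstant one_pos le_rfl).trans (ENNReal.ofReal_le_ofReal ?_)
  rw [AnisotropicRotator.klsConstant_one]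
  exact latticeGreen_three_zero_mem_Icc.2

/-- For `Δ ≥ 1` the stack's transition coupling lies below the isotropic one: `K_χ^{3D}(Δ) ≤ K_χ(3) ≤ 0.5094`.
[cite: FriedliVelenikSMLS2017, Thm 10.25 with (10.41)–(10.42); Ginibre1970, Prop. 3 with Example 4 (plane rotators)] -/
theorem layeredSusceptibilityCriticalCoupling_le_of_one_le {Δ : ℝ} (hΔ : 1 ≤ Δ) :
    layeredSusceptibilityCriticalCoupling Δ ≤ ENNReal.ofReal (5094 / 10000) :=
  ((layeredSusceptibilityCriticalCoupling_antitoneOn (Set.mem_Ici.2 zero_le_one)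
      (Set.mem_Ici.2 (zero_le_one.trans hΔ)) hΔ).trans_eq layeredSusceptibilityCriticalCoupling_one).trans
    susceptibilityCriticalCoupling_three_le

/-- **Lieb's star floor at the isotropic point: `1/3 ≤ K_χ(3)`** (`6u(1/3) = 6/√37 < 1`): with the Watson ceiling,
**`1/3 ≤ K_χ(3) ≤ 0.5094`** — the susceptibility transition of the classical XY model on `ℤ³` is bracketed in the
kernel, `1.963·J < T_χ^{XY}(ℤ³) ≤ 3·J` (the high-temperature-series value `≈ 2.20·J` is a float, not used). [cite: Lieb1980, Theorem 4 (the star); FriedliVelenikSMLS2017, Thm 10.25] -/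
theorem one_third_le_susceptibilityCriticalCoupling_three :
    ENNReal.ofReal (1 / 3) ≤ susceptibilityCriticalCoupling 3 := by
  rw [← layeredSusceptibilityCriticalCoupling_one]
  refine ofReal_le_layeredSusceptibilityCriticalCoupling_of_amos_star_lt_one zero_le_one (by norm_num) ?_
  have hs : (2 : ℝ) < Real.sqrt ((1 / 3 : ℝ) ^ 2 + 4) := by
    rw [show ((1 : ℝ) / 3) ^ 2 + 4 = 37 / 9 by norm_num, Real.lt_sqrt (by norm_num)]
    norm_num
  have hu : (1 / 3 : ℝ) / Real.sqrt ((1 / 3 : ℝ) ^ 2 + 4) < 1 / 6 := by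
    rw [div_lt_iff₀ (lt_trans two_pos hs)]
    nlinarith
  rw [one_mul]
  linarith

/-- **Both ceilings at every anisotropy `0 < Δ ≤ 1`, in one line**: `K_χ^{3D}(Δ) ≤ min (K_χ(2), C(Δ))` — below the
single layer's transition coupling (Griffiths–Ginibre) and below the infrared-bound constant (reflection positivity).
Which of the two is smaller is not decided in the tree (`K_χ(2)` has no upper kernel number without Fröhlich–Spencer).
[cite: FILS1978, Thm. 4.7; Ginibre1970, Prop. 3 with Example 4 (plane rotators); Simon1980CMP, Thm 1.3] -/
theorem layeredSusceptibilityCriticalCoupling_le_min {Δ : ℝ} (hΔ0 : 0 < Δ) (hΔ1 : Δ ≤ 1) :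
    layeredSusceptibilityCriticalCoupling Δ ≤
      min (susceptibilityCriticalCoupling 2) (ENNReal.ofReal (AnisotropicRotator.klsConstant Δ)) :=
  le_min (layeredSusceptibilityCriticalCoupling_le hΔ0.le) (layeredSusceptibilityCriticalCoupling_le_klsConstant hΔ0 hΔ1)

end InfraredCeilings

section Temperature

variable [MeasurableSpace Circle] [BorelSpace Circle]

/-! ## §5 Temperature forms: `T_Υ^{2D}(J) ≤ T_χ^{2D}(J) ≤ J/(2β_c(2))`, `T_χ^{2D}(J∥) ≤ T_χ^{3D}(J∥, ΔJ∥) ↓ T_χ^{2D}(J∥)` -/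

/-- **`T_Υ(J) ≤ T_χ(J)`** — the structural half in temperature units: with `T_χ^{2D}(J) := J/K_χ(2)` and
`T_Υ^{2D}(J) := J/K_Υ` (extended-real quotients: `J/∞ = 0` = «no transition at any positive temperature»), the
stiffness onset temperature of the two-dimensional plane rotator lies at or below its susceptibility transition
temperature, for every `J`. [cite: Simon1980CMP, Thm 1.3; Lieb1980, p. 128 (boxes); FisherBarberJasnow1973, §II eq. (2.5)] -/
theorem stiffnessTemperature_le_susceptibilityTemperature (J : ℝ) :
    ENNReal.ofReal J / stiffnessCriticalCoupling ≤ ENNReal.ofReal J / susceptibilityCriticalCoupling 2 :=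
  ENNReal.div_le_div_left susceptibilityCriticalCoupling_two_le_stiffnessCriticalCoupling _

/-- **`T_χ^{2D}(J) ≤ J/(2β_c(2))`** (`= ½·T_c^{Ising}(ℤ²)·J`; Aizenman–Simon), hence `≤ J/log(1+√2) < 1.1346·J`.
[cite: AizenmanSimon1980RotorIsing, eq. (2)] -/
theorem susceptibilityTemperature_two_le (J : ℝ) :
    ENNReal.ofReal J / susceptibilityCriticalCoupling 2 ≤ ENNReal.ofReal (J / (2 * criticalBeta 2)) := by
  rw [ENNReal.ofReal_div_of_pos two_mul_criticalBeta_two_pos]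
  exact ENNReal.div_le_div_left (two_mul_criticalBeta_le_susceptibilityCriticalCoupling le_rfl) _

/-- **`T_Υ^{2D}(J) ≤ J/(2β_c(2))`**: no stiffness onset of the comparison model above `J/(2β_c(2)) ≤ 1.1346·J`.
[cite: AizenmanSimon1980RotorIsing, eq. (2); FisherBarberJasnow1973, §II eq. (2.5)] -/
theorem stiffnessTemperature_le (J : ℝ) :
    ENNReal.ofReal J / stiffnessCriticalCoupling ≤ ENNReal.ofReal (J / (2 * criticalBeta 2)) :=
  (stiffnessTemperature_le_susceptibilityTemperature J).trans (susceptibilityTemperature_two_le J)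

/-- **`T_χ^{2D}(J∥) ≤ T_χ^{3D}(J∥, ΔJ∥)`** for every anisotropy `Δ ≥ 0`, with `T_χ^{3D}(J∥, ΔJ∥) := J∥/K_χ^{3D}(Δ)`:
interlayer coupling cannot lower the susceptibility transition temperature. [cite: LiuStanley1972, p. 272 (T_c(ε) ≥ T_c(0)); Ginibre1970, Prop. 3 with Example 4 (plane rotators)] -/
theorem susceptibilityTemperature_two_le_layered (J : ℝ) {Δ : ℝ} (hΔ : 0 ≤ Δ) :
    ENNReal.ofReal J / susceptibilityCriticalCoupling 2 ≤ ENNReal.ofReal J / layeredSusceptibilityCriticalCoupling Δ :=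
  ENNReal.div_le_div_left (layeredSusceptibilityCriticalCoupling_le hΔ) _

/-- **`T_χ^{3D}(J∥, ΔJ∥) → T_χ^{2D}(J∥)` as `Δ → 0⁺`** (Liu–Stanley's limit for the susceptibility transition of the
classical layered XY model, from above by the previous lemma). [cite: LiuStanley1972, p. 272 (T_c(ε) → T_c^{2D} as ε → 0); Simon1980CMP, Thm 1.3] -/
theorem tendsto_layeredSusceptibilityTemperature_zero (J : ℝ) :
    Tendsto (fun Δ : ℝ => ENNReal.ofReal J / layeredSusceptibilityCriticalCoupling Δ) (𝓝[>] 0)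
      (𝓝 (ENNReal.ofReal J / susceptibilityCriticalCoupling 2)) :=
  ENNReal.Tendsto.const_div tendsto_layeredSusceptibilityCriticalCoupling_zero (Or.inr ENNReal.ofReal_ne_top)

end Temperature

/-! ## §6 Dimension comparison: `K_χ(3) < K_χ(2)` -/

section Dimension

/-- **The isotropic three-dimensional transition lies strictly below the two-dimensional one on the coupling axis:
`K_χ(3) < K_χ(2)`** — `K_χ(3) ≤ R(3) ≤ 0.5094` (infrared-bound ceiling with Watson's constant,
`susceptibilityCriticalCoupling_three_le`) while `0.88137 < log(1+√2) ≤ K_χ(2)` (Aizenman–Simon–Onsager window,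
`lt_log_one_add_sqrt_two`, `log_one_add_sqrt_two_le_susceptibilityCriticalCoupling_two`); in temperature units
`T_χ^{XY}(ℤ³) ≥ 1.963·J > 1.1346·J ≥ T_χ^{XY}(ℤ²)` as typed numbers (the Griffiths–Ginibre embedding `ℤ² ⊂ ℤ³` would
give the non-strict `K_χ(3) ≤ K_χ(2)` without numbers; not used). Stated at the tree's canonical Borel structure on
`Circle`, like the ceiling it uses. [cite: FriedliVelenikSMLS2017, Thm 10.25 with (10.41)–(10.42); AizenmanSimon1980RotorIsing, eq. (2); Guttmann2010, §2.1 (Watson's integral)] -/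
theorem susceptibilityCriticalCoupling_three_lt_two :
    susceptibilityCriticalCoupling 3 < susceptibilityCriticalCoupling 2 := by
  refine susceptibilityCriticalCoupling_three_le.trans_lt (lt_of_lt_of_le ?_
    log_one_add_sqrt_two_le_susceptibilityCriticalCoupling_two)
  rw [ENNReal.ofReal_lt_ofReal_iff_of_nonneg (by norm_num)]
  exact lt_trans (by norm_num) lt_log_one_add_sqrt_two

end Dimension

end PlaneRotator

end Literature.Probability.LatticeModels

end
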